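import Literature.Barriers.Schanuel.NesterenkoModularScopeTransfer
import Literature.Barriers.Schanuel.NesterenkoModularScopeMeasureClaim
import Literature.NumberTheory.Transcendental.NesterenkoEliminationProp47Holds
import Literature.NumberTheory.Transcendental.NesterenkoEliminationProp413Holds
import Literature.NumberTheory.Transcendental.NesterenkoEliminationFacts2Proofs
import Literature.NumberTheory.Transcendental.PhilipponCriterionPrincipal
import Literature.NumberTheory.Transcendental.NesterenkoEliminationProp411Holds
import HarnessLib

/-!
# Barrier (Schanuel) `NesterenkoModularScope`: the transfer principle — part 2, the `z`-adic toolkit of Ch. 10 §2 from the archimedean one of Ch. 3 §4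

Proofs-only sibling of `NesterenkoModularScopeTransfer.lean`; nothing is asserted as a fact.

For a FIXED homogeneous ideal of `ℚ[x₀, …, x₄]` the archimedean Propositions 4.7, 4.8, 4.11, 4.13 and
Corollary 4.9 of LNM 1752 Ch. 3 §4 (all proved in the tree for `K = ℚ`), applied at the complex points
`ω̄(z) = (1, z, P(z), Q(z), R(z))` and combined with the asymptotics `|I(ω̄(z))| ≍ |z|^{ord I}`,
`‖C‖_{ω̄(z)} ≍ |z|^{ord C(ω̂)}` of part 1, yield the exact (`z`-adic, error-free) inequalities that
Nesterenko's Ch. 10 uses over `K = ℂ(z)` — here for the variable `z` projectivised as the coordinate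
`x₁` over the constant field `ℚ`:

* `ordI_le_sum_primaryExponent_smul` — Prop. 4.7 3): `ord I ≤ ∑ k_j ord 𝔭_j`;
* `ordAlongQ_le_ordI_span_singleton` — Prop. 4.8 3): `ord P(ω̂) ≤ ord (P)`;
* `ordI_le_smul_ordAlongQ_of_mem` — Prop. 4.13 with Cor. 4.9: `ord 𝔭 ≤ r · deg 𝔭 · ord C(ω̂)` for
  every homogeneous `C ∈ 𝔭`;
* `exists_bezout`, `exists_bezout_of_ordAlongQ_lt` — Prop. 4.11: the Bézout step
  `deg J ≤ deg 𝔭 · deg B`, `ord J ≥ ord 𝔭` for `B ∉ 𝔭` with `‖B‖_ω̄ ≤ ρ` near `z = 0` (e.g. vanishing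
  along `ω̂` to higher order than some member of `𝔭`).

## References

* [NesterenkoPhilippon2001] Yu. V. Nesterenko, P. Philippon (eds.), *Introduction to Algebraic
  Independence Theory*, LNM 1752, Springer 2001, Ch. 3 §4 Props. 4.7, 4.8, 4.11, 4.13, Cor. 4.9
  (pp. 39–41) and their error-free non-archimedean forms; Ch. 10 §2 (p. 153), §4 (pp. 159–161).
-/

noncomputable section

open Complex MvPolynomial Filter Topology
open Literature.NumberTheory.Transcendental Literature.NumberTheory.Transcendental.Nesterenko

attribute [local instance] MvPolynomial.gradedAlgebra

namespace Literature.Barriers.Schanuel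

namespace Transfer

/-! ### Generic transfer lemmas -/

/-- A lower rate for a quantity dominated by `|I(ω̄(z))|` bounds `ord I` from above:
if `c|z|^a ≤ K |I(ω̄(z))|` near `0` (`c > 0`) then `ord I ≤ a`. [folklore] -/
theorem ordI_le_of_eventually_pow_le {I : Ideal (Rx 4)} {r a : ℕ} {c K : ℝ} (hc : 0 < c)
    (h : ∀ᶠ z in 𝓝 (0 : ℂ), c * ‖z‖ ^ a ≤ K * iabs I r (nesterenkoOmega z)) : ordI I r ≤ a := by
  rcases eq_or_ne (ordI I r) ⊤ with htop | hne
  · exfalso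
    have h0 : ∀ᶠ z in 𝓝 (0 : ℂ), c * ‖z‖ ^ a ≤ 0 * ‖z‖ ^ (a + 1) := by
      filter_upwards [h, Metric.ball_mem_nhds (0 : ℂ) one_pos] with z hz hz1
      rw [Metric.mem_ball, dist_zero_right] at hz1
      rw [iabs_eq_zero_of_ordI_eq_top htop hz1, mul_zero] at hz
      simpa using hz
    have := le_of_eventually_pow_le hc h0
    omega
  · obtain ⟨V, hV⟩ := ENat.ne_top_iff_exists.mp hne
    obtain ⟨c', C, -, hC, hev⟩ := exists_bounds_iabs hV.symm
    rw [← hV]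
    have hle : ∀ᶠ z in 𝓝 (0 : ℂ), c * ‖z‖ ^ a ≤ |K| * C * ‖z‖ ^ V := by
      filter_upwards [h, hev] with z hz hz'
      calc c * ‖z‖ ^ a ≤ K * iabs I r (nesterenkoOmega z) := hz
        _ ≤ |K| * iabs I r (nesterenkoOmega z) :=
            mul_le_mul_of_nonneg_right (le_abs_self K) (iabs_nonneg _ _ _)
        _ ≤ |K| * (C * ‖z‖ ^ V) := mul_le_mul_of_nonneg_left hz'.2 (abs_nonneg K)
        _ = |K| * C * ‖z‖ ^ V := by ring
    exact_mod_cast le_of_eventually_pow_le hc hle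

/-- If `|I(ω̄(z))| ≤ K ‖P‖_{ω̄(z)}` near `0` then `ord P(ω̂) ≤ ord I`. [folklore] -/
theorem ordAlongQ_le_ordI_of_eventually_le {I : Ideal (Rx 4)} {r : ℕ} {P : Rx 4} {K : ℝ}
    (h : ∀ᶠ z in 𝓝 (0 : ℂ), iabs I r (nesterenkoOmega z) ≤ K * normAt (nesterenkoOmega z) P) :
    ordAlongQ P ≤ ordI I r := by
  rcases eq_or_ne (ordI I r) ⊤ with htop | hne
  · rw [htop]; exact le_top
  obtain ⟨V, hV⟩ := ENat.ne_top_iff_exists.mp hne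
  obtain ⟨c, C, hc, -, hev⟩ := exists_bounds_iabs hV.symm
  rw [← hV]
  rcases eq_or_ne (ordAlongQ P) ⊤ with hPtop | hPne
  · exfalso
    have h0 : ∀ᶠ z in 𝓝 (0 : ℂ), c * ‖z‖ ^ V ≤ 0 * ‖z‖ ^ (V + 1) := by
      filter_upwards [h, hev, Metric.ball_mem_nhds (0 : ℂ) one_pos] with z hz hz' hz1
      rw [Metric.mem_ball, dist_zero_right] at hz1
      rw [normAt_eq_zero_of_ordAlongQ_eq_top hPtop hz1, mul_zero] at hz
      have := hz'.1.trans hz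
      simpa using this
    have := le_of_eventually_pow_le hc h0
    omega
  · obtain ⟨v, hv⟩ := ENat.ne_top_iff_exists.mp hPne
    obtain ⟨c', C', -, hC', hev'⟩ := exists_bounds_normAt hv.symm
    rw [← hv]
    have hle : ∀ᶠ z in 𝓝 (0 : ℂ), c * ‖z‖ ^ V ≤ |K| * C' * ‖z‖ ^ v := by
      filter_upwards [h, hev, hev'] with z hz hz' hz''
      calc c * ‖z‖ ^ V ≤ iabs I r (nesterenkoOmega z) := hz'.1
        _ ≤ K * normAt (nesterenkoOmega z) P := hz
        _ ≤ |K| * normAt (nesterenkoOmega z) P :=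
            mul_le_mul_of_nonneg_right (le_abs_self K) (normAt_nonneg _ _)
        _ ≤ |K| * (C' * ‖z‖ ^ v) := mul_le_mul_of_nonneg_left hz''.2 (abs_nonneg K)
        _ = |K| * C' * ‖z‖ ^ v := by ring
    exact_mod_cast le_of_eventually_pow_le hc hle

/-- If `‖C‖_{ω̄(z)}^n ≤ K |I(ω̄(z))|` near `0` (`n ≥ 1`) then `ord I ≤ n · ord C(ω̂)`. [folklore] -/
theorem ordI_le_smul_ordAlongQ_of_eventually_le {I : Ideal (Rx 4)} {r n : ℕ} {P : Rx 4} {K : ℝ}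
    (hn : 1 ≤ n)
    (h : ∀ᶠ z in 𝓝 (0 : ℂ), normAt (nesterenkoOmega z) P ^ n ≤ K * iabs I r (nesterenkoOmega z)) :
    ordI I r ≤ n • ordAlongQ P := by
  rcases eq_or_ne (ordAlongQ P) ⊤ with hPtop | hPne
  · rw [hPtop, nsmul_eq_mul, ENat.mul_top (by exact_mod_cast (show n ≠ 0 by omega))]
    exact le_top
  obtain ⟨v, hv⟩ := ENat.ne_top_iff_exists.mp hPne
  obtain ⟨c, C, hc, -, hev⟩ := exists_bounds_normAt hv.symm
  rw [← hv]
  have hle : ∀ᶠ z in 𝓝 (0 : ℂ), c ^ n * ‖z‖ ^ (n * v) ≤ K * iabs I r (nesterenkoOmega z) := by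
    filter_upwards [h, hev] with z hz hz'
    calc c ^ n * ‖z‖ ^ (n * v) = (c * ‖z‖ ^ v) ^ n := by rw [mul_pow, ← pow_mul, mul_comm v]
      _ ≤ normAt (nesterenkoOmega z) P ^ n := pow_le_pow_left₀ (by positivity) hz'.1 n
      _ ≤ K * iabs I r (nesterenkoOmega z) := hz
  have := ordI_le_of_eventually_pow_le (pow_pos hc n) hle
  calc ordI I r ≤ ((n * v : ℕ) : ℕ∞) := this
    _ = n • (v : ℕ∞) := by rw [nsmul_eq_mul]; push_cast; ring

/-- If `|J(ω̄(z))| ≤ K |I(ω̄(z))|` near `0` then `ord I ≤ ord J`. [folklore] -/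
theorem ordI_le_ordI_of_eventually_le {I J : Ideal (Rx 4)} {r s : ℕ} {K : ℝ}
    (h : ∀ᶠ z in 𝓝 (0 : ℂ), iabs J s (nesterenkoOmega z) ≤ K * iabs I r (nesterenkoOmega z)) :
    ordI I r ≤ ordI J s := by
  rcases eq_or_ne (ordI J s) ⊤ with htop | hne
  · rw [htop]; exact le_top
  obtain ⟨V, hV⟩ := ENat.ne_top_iff_exists.mp hne
  obtain ⟨c, C, hc, -, hev⟩ := exists_bounds_iabs hV.symm
  rw [← hV]
  refine ordI_le_of_eventually_pow_le (K := K) hc ?_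
  filter_upwards [h, hev] with z hz hz'
  exact hz'.1.trans hz

/-! ### Proposition 4.7 3) along the curve -/

/-- **Prop. 4.7 3), `z`-adic form: `ord I ≤ ∑_j k_j · ord 𝔭_j`** for a homogeneous unmixed ideal
`I ⊂ ℚ[x₀, …, x₄]` with `dim I = r − 1`, `1 ≤ r ≤ 4`, and its reduced primary decomposition (the
printed non-archimedean statement is the equality `∑ k_j log |𝔭_j(ω̄)| = log |I(ω̄)|`; the inequality
is what Ch. 10 §4 uses). [cite: NesterenkoPhilippon2001, Ch. 3 Prop. 4.7 3) (p. 39); Ch. 10 §4 (p. 160)] -/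
theorem ordI_le_sum_primaryExponent_smul {r : ℕ} {I : Ideal (Rx 4)} (hr1 : 1 ≤ r) (hr4 : r ≤ 4)
    (hhom : I.IsHomogeneous (homogeneousSubmodule (Fin 5) ℚ)) (hunm : IsUnmixedOfRank I r)
    {t : Finset (Ideal (Rx 4))} (ht : Submodule.IsMinimalPrimaryDecomposition I t) :
    ordI I r ≤ ∑ Q ∈ t, primaryExponent Q • ordI Q.radical r := by
  classical
  -- exponents are positive
  have hkpos : ∀ Q ∈ t, 1 ≤ primaryExponent Q := fun Q hQ =>
    primaryExponent_pos (ht.primary hQ).1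
  by_cases hall : ∀ Q ∈ t, ordI Q.radical r ≠ ⊤
  · -- all the `ord 𝔭_j` are finite: compare rates
    have hfin : ∀ Q ∈ t, ∃ V : ℕ, ordI Q.radical r = V := fun Q hQ =>
      (ENat.ne_top_iff_exists.mp (hall Q hQ)).imp fun _ h => h.symm
    choose! V hV using hfin
    have hbd : ∀ Q ∈ t, ∃ c : ℝ, 0 < c ∧ ∀ᶠ z in 𝓝 (0 : ℂ),
        c * ‖z‖ ^ V Q ≤ iabs Q.radical r (nesterenkoOmega z) := fun Q hQ => by
      obtain ⟨c, C, hc, -, hev⟩ := exists_bounds_iabs (hV Q hQ)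
      exact ⟨c, hc, hev.mono fun z hz => hz.1⟩
    choose! c hcpos hc using hbd
    have hevall : ∀ᶠ z in 𝓝 (0 : ℂ), ∀ Q ∈ t, c Q * ‖z‖ ^ V Q ≤ iabs Q.radical r (nesterenkoOmega z) :=
      (Filter.eventually_all_finset t).mpr fun Q hQ => hc Q hQ
    have h47 := NesterenkoPhilippon2001_ch3_prop_4_7_holds 4 r I hr1 hr4 hhom hunm t ht
    have hsum : (∑ Q ∈ t, primaryExponent Q • ordI Q.radical r) =
        ((∑ Q ∈ t, primaryExponent Q * V Q : ℕ) : ℕ∞) := by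
      push_cast
      exact Finset.sum_congr rfl fun Q hQ => by rw [hV Q hQ, nsmul_eq_mul]
    rw [hsum]
    refine ordI_le_of_eventually_pow_le (K := Real.exp ((4 : ℝ) ^ 3 * ideg I r))
      (c := ∏ Q ∈ t, c Q ^ primaryExponent Q) (Finset.prod_pos fun Q hQ => pow_pos (hcpos Q hQ) _) ?_
    filter_upwards [hevall] with z hz
    have h3 := (h47 (nesterenkoOmega z) (nesterenkoOmega_ne_zero z)).2.2
    calc (∏ Q ∈ t, c Q ^ primaryExponent Q) * ‖z‖ ^ (∑ Q ∈ t, primaryExponent Q * V Q)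
        = ∏ Q ∈ t, (c Q * ‖z‖ ^ V Q) ^ primaryExponent Q := by
          rw [← Finset.prod_pow_eq_pow_sum, ← Finset.prod_mul_distrib]
          refine Finset.prod_congr rfl fun Q _ => ?_
          rw [mul_pow, ← pow_mul, mul_comm (V Q)]
      _ ≤ ∏ Q ∈ t, iabs Q.radical r (nesterenkoOmega z) ^ primaryExponent Q :=
          Finset.prod_le_prod (fun Q hQ => by have := hcpos Q hQ; positivity)
            fun Q hQ => pow_le_pow_left₀ (by have := hcpos Q hQ; positivity) (hz Q hQ) _
      _ ≤ iabs I r (nesterenkoOmega z) * Real.exp ((4 : ℝ) ^ 3 * ideg I r) := by exact_mod_cast h3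
      _ = Real.exp ((4 : ℝ) ^ 3 * ideg I r) * iabs I r (nesterenkoOmega z) := mul_comm _ _
  · -- some `ord 𝔭_j = ⊤`: the right-hand side is `⊤`
    push Not at hall
    obtain ⟨Q₀, hQ₀, htop⟩ := hall
    have : primaryExponent Q₀ • ordI Q₀.radical r = ⊤ := by
      rw [htop, nsmul_eq_mul, ENat.mul_top]
      exact_mod_cast (show primaryExponent Q₀ ≠ 0 from fun h => by have := hkpos Q₀ hQ₀; omega)
    have hle : primaryExponent Q₀ • ordI Q₀.radical r ≤ ∑ Q ∈ t, primaryExponent Q • ordI Q.radical r :=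
      Finset.single_le_sum (f := fun Q => primaryExponent Q • ordI Q.radical r) (fun _ _ => bot_le) hQ₀
    rw [this, top_le_iff] at hle
    rw [hle]
    exact le_top

/-! ### Proposition 4.8 3) along the curve -/

/-- **Prop. 4.8 3), `z`-adic form: `ord P(ω̂) ≤ ord (P)`** for a non-constant homogeneous
`P ∈ ℚ[x₀, …, x₄]` (index `r = m = 4`). [cite: NesterenkoPhilippon2001, Ch. 3 Prop. 4.8 3) (p. 40); Ch. 10 §2 (51) (p. 153)] -/
theorem ordAlongQ_le_ordI_span_singleton {P : Rx 4} {d : ℕ} (hP0 : P ≠ 0) (hhom : P.IsHomogeneous d)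
    (hd : 1 ≤ d) : ordAlongQ P ≤ ordI (Ideal.span {P}) 4 := by
  have hunit : ¬ IsUnit P := by
    intro hu
    have h0 := (MvPolynomial.isUnit_iff_totalDegree_of_isReduced.mp hu).2
    rw [hhom.totalDegree hP0] at h0
    omega
  have hunm : IsUnmixedOfRank (Ideal.span {P}) 4 := PhilipponMain.isUnmixedOfRank_span_singleton hP0 hunit
  have h48 := NesterenkoPhilippon2001_ch3_prop_4_8_holds 4 P d (by norm_num) hP0 hhom hunm
  refine ordAlongQ_le_ordI_of_eventually_le (K := Real.exp (2 * (4 : ℝ) ^ 2 * d)) ?_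
  refine Filter.Eventually.of_forall fun z => ?_
  have := (h48 (nesterenkoOmega z) (nesterenkoOmega_ne_zero z)).2.2
  rw [mul_comm]
  exact_mod_cast this

/-- **`deg (P) = deg P`** (Prop. 4.8 1), recorded for the same hypotheses). [cite: NesterenkoPhilippon2001, Ch. 3 Prop. 4.8 1) (p. 40)] -/
theorem ideg_span_singleton {P : Rx 4} {d : ℕ} (hP0 : P ≠ 0) (hhom : P.IsHomogeneous d) (hd : 1 ≤ d) :
    ideg (Ideal.span {P}) 4 = d := by
  have hunit : ¬ IsUnit P := by
    intro hu
    have h0 := (MvPolynomial.isUnit_iff_totalDegree_of_isReduced.mp hu).2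
    rw [hhom.totalDegree hP0] at h0
    omega
  have hunm : IsUnmixedOfRank (Ideal.span {P}) 4 := PhilipponMain.isUnmixedOfRank_span_singleton hP0 hunit
  exact (NesterenkoPhilippon2001_ch3_prop_4_8_holds 4 P d (by norm_num) hP0 hhom hunm
    (nesterenkoOmega 0) (nesterenkoOmega_ne_zero 0)).1

/-! ### Proposition 4.13 with Corollary 4.9 along the curve -/

/-- **Deep primes vanish deeply along `ω̂`**: for a homogeneous prime `𝔭 ⊂ ℚ[x₀, …, x₄]` with
`dim 𝔭 = r − 1`, `1 ≤ r ≤ 4`, and a homogeneous `C ∈ 𝔭`: `ord 𝔭 ≤ r · deg 𝔭 · ord C(ω̂)`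
(from Prop. 4.13, a zero `β̄` of `𝔭` with `deg 𝔭 · log ‖ω̄ − β̄‖ ≤ (1/r)(log |𝔭(ω̄)| + h(𝔭)) + O(1)`, and
Cor. 4.9, `log ‖C‖_ω̄ ≤ log ‖ω̄ − β̄‖ + O(1)`; this is the quantitative content of Lemma 3.4 of Ch. 10).
[cite: NesterenkoPhilippon2001, Ch. 3 Prop. 4.13, Cor. 4.9 (pp. 40–41); Ch. 10 Lemma 3.4 (p. 155)] -/
theorem ordI_le_smul_ordAlongQ_of_mem {r : ℕ} {𝔭 : Ideal (Rx 4)} (hr1 : 1 ≤ r) (hr4 : r ≤ 4)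
    (hprime : 𝔭.IsPrime) (hhom : 𝔭.IsHomogeneous (homogeneousSubmodule (Fin 5) ℚ))
    (hunm : IsUnmixedOfRank 𝔭 r) {C : Rx 4} {d : ℕ} (hC : C ∈ 𝔭) (hChom : C.IsHomogeneous d) :
    ordI 𝔭 r ≤ (r * ideg 𝔭 r) • ordAlongQ C := by
  have hdeg : 1 ≤ ideg 𝔭 r :=
    one_le_ideg_of_isPrime NesterenkoPhilippon2001_ch3_prop_4_4_holds hr1 hr4 hprime hhom hunm
  set D := ideg 𝔭 r with hD
  -- the constants of Prop. 4.13 / Cor. 4.9 (independent of `z`)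
  set E₁ : ℝ := Real.exp ((2 * 4 + 1 : ℝ) * d) with hE₁
  set E₂ : ℝ := Real.exp (4 * (4 : ℝ) ^ 3 * D) with hE₂
  set Eh : ℝ := Real.exp (iheight 𝔭 r) with hEh
  refine ordI_le_smul_ordAlongQ_of_eventually_le (K := Eh * (E₂ * E₁ ^ D) ^ r)
    (Nat.one_le_iff_ne_zero.mpr (Nat.mul_ne_zero (by omega) (by omega))) ?_
  refine Filter.Eventually.of_forall fun z => ?_
  set ω := nesterenkoOmega z with hω
  have hω0 : ω ≠ 0 := nesterenkoOmega_ne_zero z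
  obtain ⟨β, hβ, h413⟩ :=
    NesterenkoPhilippon2001_ch3_prop_4_13_holds 4 r 𝔭 hr1 hr4 hhom hunm ω hω0
  have h49 := NesterenkoPhilippon2001_ch3_cor_4_9_holds 4 r 𝔭 hr1 hr4 hprime hhom hunm C d hC hChom ω hω0
  -- `‖C‖_ω̄ ≤ ‖ω̄ − β̄‖ · E₁`
  have h1 : normAt ω C ≤ projDist ω β * E₁ :=
    h49.trans (mul_le_mul_of_nonneg_right (rho_le_projDist ω hβ) (Real.exp_pos _).le)
  have hnn : 0 ≤ normAt ω C := normAt_nonneg _ _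
  have hpd : 0 ≤ projDist ω β := projDist_nonneg _ _
  have hiabs : 0 ≤ iabs 𝔭 r ω := iabs_nonneg _ _ _
  -- raise to the power `D`, then `r`
  have h2 : normAt ω C ^ D ≤ (iabs 𝔭 r ω * Eh) ^ (1 / (r : ℝ)) * E₂ * E₁ ^ D := by
    calc normAt ω C ^ D ≤ (projDist ω β * E₁) ^ D := pow_le_pow_left₀ hnn h1 D
      _ = projDist ω β ^ D * E₁ ^ D := mul_pow _ _ _
      _ ≤ (iabs 𝔭 r ω * Eh) ^ (1 / (r : ℝ)) * E₂ * E₁ ^ D :=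
          mul_le_mul_of_nonneg_right h413 (by positivity)
  have hr0 : (r : ℝ) ≠ 0 := by exact_mod_cast (show r ≠ 0 by omega)
  have h3 : normAt ω C ^ (r * D) ≤ iabs 𝔭 r ω * Eh * (E₂ * E₁ ^ D) ^ r := by
    have hb : 0 ≤ (iabs 𝔭 r ω * Eh) ^ (1 / (r : ℝ)) * E₂ * E₁ ^ D := by positivity
    calc normAt ω C ^ (r * D) = (normAt ω C ^ D) ^ r := by rw [mul_comm, pow_mul]
      _ ≤ ((iabs 𝔭 r ω * Eh) ^ (1 / (r : ℝ)) * E₂ * E₁ ^ D) ^ r := pow_le_pow_left₀ (by positivity) h2 r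
      _ = ((iabs 𝔭 r ω * Eh) ^ (1 / (r : ℝ))) ^ r * (E₂ * E₁ ^ D) ^ r := by rw [mul_assoc, mul_pow]
      _ = iabs 𝔭 r ω * Eh * (E₂ * E₁ ^ D) ^ r := by
          congr 1
          rw [← Real.rpow_natCast, ← Real.rpow_mul (by positivity), one_div_mul_cancel hr0,
            Real.rpow_one]
  calc normAt ω C ^ (r * D) ≤ iabs 𝔭 r ω * Eh * (E₂ * E₁ ^ D) ^ r := h3
    _ = Eh * (E₂ * E₁ ^ D) ^ r * iabs 𝔭 r ω := by ring

/-- In particular (with `C` of finite order): `ord 𝔭 ≤ r · deg 𝔭 · ord C(ω̂)` in `ℕ`. A prime all of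
whose members vanish along `ω̂` (i.e. contained in the ideal of the curve) is excluded by
`ord C(ω̂) < ⊤`. [cite: NesterenkoPhilippon2001, Ch. 10 Lemma 3.4 (p. 155)] -/
theorem ordI_le_of_mem_of_ordAlongQ_eq {r : ℕ} {𝔭 : Ideal (Rx 4)} (hr1 : 1 ≤ r) (hr4 : r ≤ 4)
    (hprime : 𝔭.IsPrime) (hhom : 𝔭.IsHomogeneous (homogeneousSubmodule (Fin 5) ℚ))
    (hunm : IsUnmixedOfRank 𝔭 r) {C : Rx 4} {d v : ℕ} (hC : C ∈ 𝔭) (hChom : C.IsHomogeneous d)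
    (hv : ordAlongQ C = v) : ordI 𝔭 r ≤ ((r * ideg 𝔭 r * v : ℕ) : ℕ∞) := by
  have := ordI_le_smul_ordAlongQ_of_mem hr1 hr4 hprime hhom hunm hC hChom
  rw [hv, nsmul_eq_mul] at this
  exact_mod_cast this

/-- `x₀ ∉ 𝔭` as soon as `ord 𝔭 ≥ 1`: `x₀(ω̂) = 1` has order `0`.
[cite: NesterenkoPhilippon2001, Ch. 10 Lemma 3.4 (p. 155)] -/
theorem X_zero_notMem_of_one_le_ordI {r : ℕ} {𝔭 : Ideal (Rx 4)} (hr1 : 1 ≤ r) (hr4 : r ≤ 4)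
    (hprime : 𝔭.IsPrime) (hhom : 𝔭.IsHomogeneous (homogeneousSubmodule (Fin 5) ℚ))
    (hunm : IsUnmixedOfRank 𝔭 r) (hdeep : 1 ≤ ordI 𝔭 r) : (X 0 : Rx 4) ∉ 𝔭 := by
  intro hmem
  have := ordI_le_of_mem_of_ordAlongQ_eq hr1 hr4 hprime hhom hunm hmem (isHomogeneous_X ℚ 0)
    (v := 0) (by rw [ordAlongQ_X_zero]; rfl)
  rw [mul_zero, Nat.cast_zero, nonpos_iff_eq_zero] at this
  rw [this] at hdeep
  exact absurd hdeep (by decide)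

/-- `x₁ = z ∉ 𝔭` as soon as `ord 𝔭 > r · deg 𝔭`: `x₁(ω̂) = z` has order `1`.
[cite: NesterenkoPhilippon2001, Ch. 10 Lemma 3.4 (p. 155)] -/
theorem X_one_notMem_of_lt_ordI {r : ℕ} {𝔭 : Ideal (Rx 4)} (hr1 : 1 ≤ r) (hr4 : r ≤ 4)
    (hprime : 𝔭.IsPrime) (hhom : 𝔭.IsHomogeneous (homogeneousSubmodule (Fin 5) ℚ))
    (hunm : IsUnmixedOfRank 𝔭 r) (hdeep : ((r * ideg 𝔭 r : ℕ) : ℕ∞) < ordI 𝔭 r) : (X 1 : Rx 4) ∉ 𝔭 := by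
  intro hmem
  have := ordI_le_of_mem_of_ordAlongQ_eq hr1 hr4 hprime hhom hunm hmem (isHomogeneous_X ℚ 1)
    (v := 1) (by rw [ordAlongQ_X_one]; rfl)
  rw [mul_one] at this
  exact absurd (hdeep.trans_le this) (lt_irrefl _)

/-! ### Proposition 4.11 along the curve -/

/-- The hypothesis `‖B‖_ω̄ ≤ ρ` of the Bézout step (so that `δ = |𝔭(ω̄)|` in Prop. 4.11 3)) near
`z = 0`, from a member `A ∈ 𝔭` vanishing along `ω̂` to lower order than `B` (in print `B = C²`,
`C = TA`, (61) and (67)–(68)): by Cor. 4.9, `ρ(ω̄(z)) ≥ ‖A‖_{ω̄(z)} e^{−9 deg A} ≳ |z|^{ord A}` while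
`‖B‖_{ω̄(z)} ≲ |z|^{ord B}`. [cite: NesterenkoPhilippon2001, Ch. 10 §3 (61), (67)–(68) (pp. 156, 159)] -/
theorem eventually_normAt_le_rho {r : ℕ} {𝔭 : Ideal (Rx 4)} (hr1 : 1 ≤ r) (hr4 : r ≤ 4)
    (hprime : 𝔭.IsPrime) (hhom : 𝔭.IsHomogeneous (homogeneousSubmodule (Fin 5) ℚ))
    (hunm : IsUnmixedOfRank 𝔭 r) {B : Rx 4} {A : Rx 4} {a : ℕ} (hA : A ∈ 𝔭) (hAhom : A.IsHomogeneous a)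
    (hAB : ordAlongQ A < ordAlongQ B) :
    ∀ᶠ z in 𝓝 (0 : ℂ), normAt (nesterenkoOmega z) B ≤ rho (nesterenkoOmega z) 𝔭 := by
  obtain ⟨v, hv⟩ : ∃ v : ℕ, ordAlongQ A = v :=
    (ENat.ne_top_iff_exists.mp (hAB.trans_le le_top).ne).imp fun _ h => h.symm
  obtain ⟨cA, CA, hcA, -, hevA⟩ := exists_bounds_normAt hv
  have h49 := NesterenkoPhilippon2001_ch3_cor_4_9_holds 4 r 𝔭 hr1 hr4 hprime hhom hunm A a hA hAhom
  set EA : ℝ := Real.exp ((2 * 4 + 1 : ℝ) * a) with hEA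
  -- `ρ(ω̄(z)) ≥ (cA/EA) |z|^v`
  have hrho : ∀ᶠ z in 𝓝 (0 : ℂ), cA / EA * ‖z‖ ^ v ≤ rho (nesterenkoOmega z) 𝔭 := by
    filter_upwards [hevA] with z hz
    have h := (hz.1.trans (h49 (nesterenkoOmega z) (nesterenkoOmega_ne_zero z)))
    rw [div_mul_eq_mul_div, div_le_iff₀ (Real.exp_pos _)]
    exact h
  -- `‖B‖_{ω̄(z)} ≤ (cA/EA) |z|^v` near `0` since `ord B > v`
  have hB_small : ∀ᶠ z in 𝓝 (0 : ℂ), normAt (nesterenkoOmega z) B ≤ cA / EA * ‖z‖ ^ v := by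
    rcases eq_or_ne (ordAlongQ B) ⊤ with hBtop | hBne
    · filter_upwards [Metric.ball_mem_nhds (0 : ℂ) one_pos] with z hz1
      rw [Metric.mem_ball, dist_zero_right] at hz1
      rw [normAt_eq_zero_of_ordAlongQ_eq_top hBtop hz1]
      positivity
    · obtain ⟨w, hw⟩ := ENat.ne_top_iff_exists.mp hBne
      have hvw : v < w := by
        have := hAB
        rw [hv, ← hw] at this
        exact_mod_cast this
      obtain ⟨cB, CB, -, hCB, hevB⟩ := exists_bounds_normAt hw.symm
      have hpos : 0 < cA / EA := div_pos hcA (Real.exp_pos _)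
      filter_upwards [hevB, Metric.ball_mem_nhds (0 : ℂ)
        (show (0 : ℝ) < min 1 (cA / EA / CB) from lt_min one_pos (div_pos hpos hCB))] with z hz hz1
      rw [Metric.mem_ball, dist_zero_right, lt_min_iff] at hz1
      obtain ⟨e, rfl⟩ := Nat.exists_eq_add_of_lt hvw
      calc normAt (nesterenkoOmega z) B ≤ CB * ‖z‖ ^ (v + e + 1) := hz.2
        _ = CB * ‖z‖ ^ (e + 1) * ‖z‖ ^ v := by ring
        _ ≤ CB * ‖z‖ * ‖z‖ ^ v := by
            refine mul_le_mul_of_nonneg_right (mul_le_mul_of_nonneg_left ?_ hCB.le) (by positivity)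
            calc ‖z‖ ^ (e + 1) ≤ ‖z‖ ^ 1 := pow_le_pow_of_le_one (norm_nonneg _) hz1.1.le (by omega)
              _ = ‖z‖ := pow_one _
        _ ≤ CB * (cA / EA / CB) * ‖z‖ ^ v := by
            refine mul_le_mul_of_nonneg_right (mul_le_mul_of_nonneg_left hz1.2.le hCB.le) (by positivity)
        _ = cA / EA * ‖z‖ ^ v := by field_simp
  filter_upwards [hrho, hB_small] with z hz hz'
  exact hz'.trans hz

/-- **The Bézout step of Ch. 10 §4, (71)–(72), `z`-adic form** (from the tree's discharged
Prop. 4.11 of Ch. 3, `NesterenkoPhilippon2001_ch3_prop_4_11_holds`). Let `𝔭 ⊂ ℚ[x₀, …, x₄]` be a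
homogeneous prime with `dim 𝔭 = r − 1`, `2 ≤ r ≤ 4`, `B ∉ 𝔭` homogeneous of degree `d ≥ 1` with
`‖B‖_{ω̄(z)} ≤ ρ(ω̄(z))` near `z = 0` (so that `δ = |𝔭(ω̄)|` in Prop. 4.11 3); see
`eventually_normAt_le_rho`). Then there is a homogeneous unmixed `J`, `dim J = r − 2`,
`V(J) = V(𝔭, B)`, with `deg J ≤ deg 𝔭 · deg B` and `ord J ≥ ord 𝔭`.
[cite: NesterenkoPhilippon2001, Ch. 3 Prop. 4.11 (pp. 40–41); Ch. 10 §4 (71)–(72) (pp. 160–161)] -/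
theorem exists_bezout {r : ℕ} {𝔭 : Ideal (Rx 4)} (hr2 : 2 ≤ r) (hr4 : r ≤ 4)
    (hprime : 𝔭.IsPrime) (hhom : 𝔭.IsHomogeneous (homogeneousSubmodule (Fin 5) ℚ))
    (hunm : IsUnmixedOfRank 𝔭 r) {B : Rx 4} {d : ℕ} (hBhom : B.IsHomogeneous d) (hd : 1 ≤ d)
    (hB : B ∉ 𝔭) (hsmall : ∀ᶠ z in 𝓝 (0 : ℂ), normAt (nesterenkoOmega z) B ≤ rho (nesterenkoOmega z) 𝔭) :
    ∃ J : Ideal (Rx 4), J.IsHomogeneous (homogeneousSubmodule (Fin 5) ℚ) ∧ IsUnmixedOfRank J (r - 1) ∧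
      projZeros J = projZeros (𝔭 ⊔ Ideal.span {B}) ∧
      ideg J (r - 1) ≤ ideg 𝔭 r * d ∧ ordI 𝔭 r ≤ ordI J (r - 1) := by
  have hr1 : 1 ≤ r := by omega
  obtain ⟨J, hJhom, hJunm, hJzeros, hJdeg, -, hJabs⟩ :=
    (NesterenkoPhilippon2001_ch3_prop_4_11_holds 4 r 𝔭 B d hr1 hr4 hprime hhom hunm hBhom hd hB).1 hr2
  refine ⟨J, hJhom, hJunm, hJzeros, hJdeg, ?_⟩
  refine ordI_le_ordI_of_eventually_le
    (K := Real.exp (height B * ideg 𝔭 r + iheight 𝔭 r * d + 11 * (4 : ℝ) ^ 2 * ideg 𝔭 r * d)) ?_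
  filter_upwards [hsmall] with z hz
  have hδ : bezoutDelta 𝔭 r B (nesterenkoOmega z) = iabs 𝔭 r (nesterenkoOmega z) :=
    bezoutDelta_of_le hz
  have := hJabs (nesterenkoOmega z) (nesterenkoOmega_ne_zero z)
  rw [hδ, mul_comm] at this
  exact_mod_cast this

/-- The Bézout step with the smallness hypothesis in its printed form: some homogeneous `A ∈ 𝔭`
vanishes along `ω̂` to lower order than `B`. [cite: NesterenkoPhilippon2001, Ch. 10 §3 Prop. 3.6 (61), §4 (71)–(72) (pp. 156–161)] -/
theorem exists_bezout_of_ordAlongQ_lt {r : ℕ} {𝔭 : Ideal (Rx 4)} (hr2 : 2 ≤ r) (hr4 : r ≤ 4)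
    (hprime : 𝔭.IsPrime) (hhom : 𝔭.IsHomogeneous (homogeneousSubmodule (Fin 5) ℚ))
    (hunm : IsUnmixedOfRank 𝔭 r) {B : Rx 4} {d : ℕ} (hBhom : B.IsHomogeneous d) (hd : 1 ≤ d)
    (hB : B ∉ 𝔭) {A : Rx 4} {a : ℕ} (hA : A ∈ 𝔭) (hAhom : A.IsHomogeneous a)
    (hAB : ordAlongQ A < ordAlongQ B) :
    ∃ J : Ideal (Rx 4), J.IsHomogeneous (homogeneousSubmodule (Fin 5) ℚ) ∧ IsUnmixedOfRank J (r - 1) ∧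
      projZeros J = projZeros (𝔭 ⊔ Ideal.span {B}) ∧
      ideg J (r - 1) ≤ ideg 𝔭 r * d ∧ ordI 𝔭 r ≤ ordI J (r - 1) :=
  exists_bezout hr2 hr4 hprime hhom hunm hBhom hd hB
    (eventually_normAt_le_rho (by omega) hr4 hprime hhom hunm hA hAhom hAB)

end Transfer

end Literature.Barriers.Schanuel

end
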